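import Summits.HodgeConjecture.HodgeConjecture.Theorems.Ring2HypothesesDescent
import Summits.HodgeConjecture.HodgeConjecture.Theorems.Ring2HypothesesCMPivot
import Summits.HodgeConjecture.HodgeConjecture.Theorems.Ring2DeformCMPivotAnchors
import Summits.HodgeConjecture.HodgeConjecture.Theorems.Ring2BindersAbelianSchemeVHCLocal
import Summits.HodgeConjecture.HodgeConjecture.Theorems.Ring2DeformCompactPencils
import Summits.HodgeConjecture.HodgeConjecture.Theorems.BoundaryReadoutAbsoluteReductionStubAbsoluteOfIso
import Literature.AlgebraicGeometry.Deligne1982.PrincipleBAlgebraicAnchor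
import Literature.AlgebraicGeometry.HodgeTheory.QuasiProjectiveOfAffine
import Literature.AlgebraicGeometry.Motives.AbelianFibresOfAbelianFibre
import HarnessLib

/-!
# Ring 2 — hypotheses layer, descent axis: row b06 `AbsoluteHodgeImpliesAlgebraicAV` sits ABOVE the
# abelian variational rows b02 / b08 — granted Deligne's Principle B and Example 2.1 (a), NOT Main Theorem 2.11;
# and what `HC_CM` is worth on this axis (it re-derives Main Theorem 2.11 along the CM-anchored families)

HONEST FRAMING (page 1, verbatim the cell's standing line): **research route conditional on HC_CM; not a
corollary; Q11.4-sentence-2 already refuted in dim ≥ 3.** Nothing in this file proves a case of the Hodge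
conjecture, nothing discharges the binder of record b06 `Ring2.Hypotheses.AbsoluteHodgeImpliesAlgebraicAV`
("absolute Hodge classes on complex abelian varieties are algebraic", `Ring2HypothesesDescent`; OPEN, in the
dictionary `≡ HC_AV` modulo Deligne's Main Theorem 2.11 = the named fact
`deligne1982_hodgeClasses_abelianVariety_absoluteHodge`, table row c1), and `HC_CM` — written BY NAME as
`Theses.RankFourFaces.CMAbelianHodge`, never restated — is a CONCLUSION in §4 and an explicit HYPOTHESIS (a binder)
exactly in §5, where it is load-bearing. No definition, no new named fact, no `sorry`; every Literature input is
a PRE-EXISTING named fact of the tree, taken as a hypothesis by name: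

* `Deligne1982.deligne1982_principleB` — Deligne 1982 Thm. 2.12 (Principle B) = Charles–Schnell Thm. 11.3.7 (table
  row c22 of `BINDER-OWNERS.md`);
* `HodgeTheory.deligne1982_cycleClass_absoluteHodge` — Deligne 1982 Example 2.1 (a) (cycle classes are absolute; c23);
* `Motives.catanese2002_abelianFibres_of_abelianFibre` (§3 only) — a smooth projective family over a smooth
  irreducible quasi-projective base with ONE abelian fibre has all fibres abelian (Catanese 2002; table row c21);
* `Andre1996.andre1996_cmAnchoredPencil` / `andre1996_cmHodgeClasses_algebraicallyAnchoredPencils` (§4 only) —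
  André 1996 Lemmes 6.3.1–6.3.3 (table rows c11 / c12), through the deform seat's part IV;
* `Deligne1982.deligne1982_cmDenseMumfordTateFamilies` (§5, one corollary) — Deligne 1982 Prop. 6.1 /
  Charles–Schnell Thm. 11.5.11 (table row c8), through the deform seat's `Ring2.Deform.cmAnchoredFamilies_of_deligne1982`.

## What this file adds (cell `pub-hodge-ring2`, Hodge ladder stage 3, binder seat ring2-b06, row b06)

Seat ring2-b03's junction `Ring2BindersVariationalHodgeAbsolute` (J8)–(J9c) placed the variational rows below the
descent PARENT node `AbsoluteHodgeImpliesAlgebraic` (Deligne's question on ALL smooth projective varieties) and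
recorded, (J9c): "on this road the abelian-variety row b06 is not used — the parent node transports through
Principle B instead". On ABELIAN-fibred families the parent node is more than is needed: Principle B moves
absoluteness to the target fibre `𝒳_s`, and when `𝒳_s ≅ A'.X` is (the variety underlying) an abelian variety the
ROW b06 itself finishes — once "absolute Hodge" is moved across the abelian chart `A'.X ≅ 𝒳_s`. That transport is
the tree's THEOREM `Theorems.stub_absoluteOfIso` (fact-free; file `BoundaryReadoutAbsoluteReductionStubAbsoluteOfIso`,
stub S1 of crux `AbsoluteReduction`), which is all this file needs beyond the two seats' reductions:

* §1 (K1) `absoluteHodge_algebraic_of_iso_abelianVariety` — row b06 in CHART form (fact-free): on a smooth projective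
  `X ≅ A'.X`, absolute Hodge classes are algebraic.
* §2 (K2) `map_fiberι_mem_algebraicClasses_of_abelian_target_of_principleB` — PER INSTANCE, granted Principle B and
  Ex. 2.1 (a): in a smooth projective family over a smooth irreducible quasi-projective base, a global class rational
  and algebraic on ONE fibre is algebraic on EVERY fibre that is an abelian variety, as soon as row b06 holds (the
  anchor fibre is arbitrary; only the target fibre need be abelian).
  (K3) `abelianSchemeVHC_of_absoluteHodgeImpliesAlgebraicAV_of_principleB` — **`AbsoluteHodgeImpliesAlgebraicAV ⟹
  AbelianSchemeVHC`** (row b06 ⟹ row b02) granted the two facts: (K2) on affine bases (quasi-projective,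
  `IsQuasiProjectiveOver.of_isAffine`) and ring2-b02's hypothesis-free reduction `Ring2.Binders.abelianSchemeVHC_of_affine`.
  This SHARPENS (J9c) (hypothesis: the AV node instead of the parent node) and gives the dictionary's edge
  `b06 ⟹ b02` a modulus free of Main Theorem 2.11 (before: `b06 ⟹[2.11] HC_AV ⟹ b02`). (K3a)–(K3c): hence the
  deform seat's compact-pencil node and the Weil-type ladder's rungs R3var / R∞var (count once).
* §3 (K4) `localVHCAtCM_of_absoluteHodgeImpliesAlgebraicAV_of_principleB_of_catanese` — **row b06 ⟹ row b08
  `LocalVHCAtCM`** granted Principle B, Ex. 2.1 (a) and c21, with `U = S(ℂ)` (the GLOBAL conclusion along the base,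
  not only a germ) and with the CM hypothesis on the anchor fibre IDLE: on this road the one `HC_CM`-load-bearing row
  of the dictionary is reached without `HC_CM` and without 2.11.
* §4 (K5) consequences by composition with the deform seat's part IV (count once, theirs): granted Principle B,
  Ex. 2.1 (a) and André's Lemmes 6.3.1–6.3.3, **`AbsoluteHodgeImpliesAlgebraicAV ⟹ HC_CM`**, **`⟹ HC_AV`**, and the
  EXACTNESS statements **`AbsoluteHodgeImpliesAlgebraicAV ↔ HC_AV ↔ AbelianSchemeVHC`** — a second, 2.11-free modulus
  for the dictionary cells "b06 ≡ HC_AV modulo c1" / "b02 ≡ HC_AV modulo print". (Unsurprising in print: Deligne's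
  proof of 2.11 IS Principle B plus a CM reduction; here the CM step is André's §6.3 with "motivé" read "algébrique",
  as in `Ring2DeformCompactPencils`.)
* §5 (K6) WHAT `HC_CM` IS WORTH ON THE ABSOLUTE AXIS — **`HC_CM ∧ CMAnchoredFamilies ⟹ [Deligne's Main Theorem
  2.11]`**, i.e. the named fact c1 `deligne1982_hodgeClasses_abelianVariety_absoluteHodge` DERIVED in the kernel from
  the binder `HC_CM`, row b07 `CMAnchoredFamilies` (CITE, `⟸` c8) and the facts c22, c23: Deligne's own architecture
  (Introduction p. 6: "one shows that it suffices to prove the main result for `A` of CM-type", Prop. 6.1 + Thm. 2.12)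
  with his §§3–5 (the CM case of absoluteness) replaced by `HC_CM` (algebraic, hence absolute, Ex. 2.1 (a)). Here —
  and only here in this file — `HC_CM` is LOAD-BEARING: it supplies the CM step. (K6′) the same from c8 directly.
  (K7) Hence the CM PIVOT WITH ROW b06 IN PLACE OF ROW b08: **`HC_CM ∧ CMAnchoredFamilies ∧
  AbsoluteHodgeImpliesAlgebraicAV ⟹ HC_AV`** modulo {c22, c23} (the dictionary's
  `hc_av_of_hc_cm_of_cmAnchoredFamilies_of_localVHCAtCM` has `LocalVHCAtCM` as third input), and (K7′) its
  item-16267 form `CMAnchoredFamilies ∧ AbsoluteHodgeImpliesAlgebraicAV ⟹ CMToAbelian`.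

## HONEST COLUMN (what the kernel theorems do NOT say)

(1) No node is discharged: `AbsoluteHodgeImpliesAlgebraicAV`, `AbelianSchemeVHC`, `LocalVHCAtCM`, `HC_AV`, `HC_CM`
stay OPEN; the facts stay named facts (c1 is derived in (K6) only UNDER the open binder `HC_CM` and the CITE row
b07 — that is not a discharge); the BINDER-OWNERS numbers «10 · 0» do not move. (2) (K3)–(K5) relate statements
each of which is already `≡ HC_AV` modulo print; the gain is the MODULUS (Thm. 2.12 + Ex. 2.1 (a) in place of Main
Thm. 2.11) and the typing of (K2): per family, row b06 is consumed on the target fibre only. (3) Not claimed: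
`AbelianSchemeVHC ⟹ AbsoluteHodgeImpliesAlgebraicAV` without André's lemmas (the converse of (K3) passes through
`HC_AV`); anything on non-abelian target fibres (that is the parent node's business, (J8)); a per-instance form
over non-quasi-projective bases (Principle B is typed on good families); (K6) from the one-CM-fibre row b01
`MumfordTateCMAnchors` (its base is not quasi-projective as typed; the separated/curve forms of ring2-b01 would
do, not used here). (4) `HC_CM` is an input in §5 only, and there it is dominated MODULO PRINT like everywhere on
this axis (row b06 alone gives `HC_CM`: modulo c1 by the dictionary, modulo c12 + c22 + c23 by (K5a)); what `HC_CM`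
and row b07 buy in (K6)/(K7) is exactly the removal of c1 (resp. of André's lemmas) from the modulus — a statement
about which printed theorems the road uses, not independent evidence for `HC_AV`.

References (keys of `references.bib`): Deligne1982HodgeCycles (Introduction, principle B; Example 2.1 (a);
Main Thm. 2.11; Thm. 2.12; Rem. 2.14; Prop. 6.1; Milne's 2003 re-edition endnote 19), CharlesSchnell2014Notes
(Def. 11.2.3, Conj. 11.3.1, §11.3.2 first paragraph, Cor. 11.3.6, Thm. 11.3.7, Prop. 11.3.11), Andre1996Motifs
(§6.3, Lemmes 6.3.1–6.3.3, Remarque 2), Catanese2002DeformationTypes, Grothendieck1966 (footnote 13), SGA1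
(Exp. XII Prop. 2.4), Jouanolou1973 (Lemme 1.5).
-/

set_option linter.dupNamespace false

noncomputable section

open CategoryTheory AlgebraicGeometry
open Literature.AlgebraicGeometry Literature.AlgebraicGeometry.Motives
open Literature.AlgebraicGeometry.HodgeTheory Literature.AlgebraicGeometry.Deligne1982
open Literature.AlgebraicGeometry.Andre1996 (andre1996_cmAnchoredPencil
  andre1996_cmHodgeClasses_algebraicallyAnchoredPencils)

namespace Summit.HodgeConjecture.HodgeConjecture.Ring2.Hypotheses

/-! ## §1 Row b06 in chart form: absolute Hodge classes on a variety isomorphic to an abelian variety -/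

/-- **(K1) Row b06 across an abelian chart (fact-free).** If absolute Hodge classes on complex abelian varieties
are algebraic (`AbsoluteHodgeImpliesAlgebraicAV`), then on every smooth projective `X` of dimension `n` admitting an
isomorphism `e : A'.X ≅ X` with (the variety underlying) an abelian variety `A'`, every absolute Hodge class of
codimension `p` is algebraic: `e^* c` is absolute Hodge on `A'.X` (the tree's theorem `Theorems.stub_absoluteOfIso`:
conjugation charts compose with isomorphisms), `dim A' = n` (`Motives.schemeDim_eq_holds`), row b06 applies on `A'`,
and algebraicity moves back along `e` (`mem_algebraicClasses_map_iff_of_iso`). [cite: CharlesSchnell2014Notes, Def. 11.2.3]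
[cite: Deligne1982HodgeCycles, Introduction (absolute Hodge ⟹ Hodge) and Def. 2.10] -/
theorem absoluteHodge_algebraic_of_iso_abelianVariety (h : AbsoluteHodgeImpliesAlgebraicAV)
    {n : ℕ} {X : SchemeOver ℂ} (hX : IsSmoothProjective n X) {A' : AbelianVariety ℂ} (e : A'.X ≅ X)
    (p : ℕ) (c : complexBetti X (2 * p)) (hc : IsAbsoluteHodgeClass n X p c) :
    c ∈ algebraicClasses X p := by
  have hX' : IsSmoothProjective n A'.X := hX.of_iso e.symm
  have h₁ : IsAbsoluteHodgeClass n A'.X p (complexBetti.map e.hom (2 * p) c) :=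
    Theorems.stub_absoluteOfIso e hX hX' p c hc
  have hdim : A'.dim = n := schemeDim_eq_holds hX'
  rw [← hdim] at h₁
  exact (mem_algebraicClasses_map_iff_of_iso e).1 (h A' p _ h₁)

/-! ## §2 Row b06 ⟹ row b02: Principle B along abelian-fibred families -/

/-- **(K2) Per instance: transport of algebraicity onto an ABELIAN target fibre, granted Principle B, Example
2.1 (a) and row b06.** For `f : 𝒳 ⟶ S` smooth projective of relative dimension `n` over a smooth irreducible
QUASI-PROJECTIVE `S`, a global class `W ∈ H²ᵖ(𝒳(ℂ); ℂ)` whose restriction to ONE fibre `𝒳_{s₀}` is rational and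
algebraic, and a target `s` whose fibre `𝒳_s` is isomorphic to (the variety underlying) an abelian variety:
`W|_{𝒳_s}` is algebraic. Proof: algebraic at `s₀` ⟹ absolute Hodge at `s₀` (Ex. 2.1 (a)) ⟹ absolute Hodge at `s`
(Principle B along the continuous global section `t ↦ (t, W|_{𝒳_t})`; `S(ℂ)` is connected, SGA1 XII 2.4 — the
Literature lemma `deligne1982_principleB.map_fiberι_mem_algebraicClasses_of_absolute_target`) ⟹ algebraic at `s`
by (K1). Neither the anchor fibre nor any other fibre need be abelian, and no fibrewise Hodge condition is assumed
(it is a consequence, Deligne's Rem. 2.14). [cite: CharlesSchnell2014Notes, §11.3.2 (first paragraph) and Thm. 11.3.7]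
[cite: Deligne1982HodgeCycles, Example 2.1 (a), Thm. 2.12 and Rem. 2.14] [cite: SGA1, Exp. XII Prop. 2.4] -/
theorem map_fiberι_mem_algebraicClasses_of_abelian_target_of_principleB
    (hB : deligne1982_principleB) (hZ : deligne1982_cycleClass_absoluteHodge)
    (h : AbsoluteHodgeImpliesAlgebraicAV)
    ⦃n : ℕ⦄ ⦃𝒳 S : SchemeOver ℂ⦄ (f : 𝒳 ⟶ S) (hf : IsSmoothProjectiveFamily f n)
    (hS : IsQuasiProjectiveOver S) (hirr : IrreducibleSpace S.left) (hsm : AlgebraicGeometry.Smooth S.hom)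
    (p : ℕ) (W : complexBetti 𝒳 (2 * p)) {s₀ : ComplexPoints S}
    (hrat : IsRationalClass (complexBetti.map (fiberι f s₀) (2 * p) W))
    (halg : complexBetti.map (fiberι f s₀) (2 * p) W ∈ algebraicClasses (fiberOver f s₀) p)
    (s : ComplexPoints S) (hab : ∃ A' : AbelianVariety ℂ, Nonempty (A'.X ≅ fiberOver f s)) :
    complexBetti.map (fiberι f s) (2 * p) W ∈ algebraicClasses (fiberOver f s) p := by
  haveI := hirr
  obtain ⟨A', ⟨e⟩⟩ := hab
  exact hB.map_fiberι_mem_algebraicClasses_of_absolute_target hZ ⟨hf, hS, hsm⟩ W hrat halg s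
    fun c hc => absoluteHodge_algebraic_of_iso_abelianVariety h (hf.isSmoothProjective s) e p c hc

/-- **(K3) `AbsoluteHodgeImpliesAlgebraicAV ⟹ AbelianSchemeVHC` (row b06 ⟹ row b02), granted Principle B and
Example 2.1 (a) — NOT Deligne's Main Theorem 2.11.** Milne's (VHC) for abelian schemes in the dictionary's
global-class form over EVERY smooth irreducible base: reduce to affine bases by ring2-b02's hypothesis-free
`Ring2.Binders.abelianSchemeVHC_of_affine`; an affine smooth `ℂ`-scheme is quasi-projective
(`IsQuasiProjectiveOver.of_isAffine`), and (K2) applies fibre by fibre (every fibre is abelian; rationality at the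
algebraic fibre is part of the row's fibrewise Hodge hypothesis). Sharpens ring2-b03's (J9c)
`Ring2.Binders.abelianSchemeVHC_of_absoluteHodgeImpliesAlgebraic_of_principleB`, whose hypothesis is the parent node
`AbsoluteHodgeImpliesAlgebraic` (all smooth projective varieties). [cite: CharlesSchnell2014Notes, §11.3.2 (first paragraph), Thm. 11.3.7 and Conj. 11.3.1]
[cite: Deligne1982HodgeCycles, Thm. 2.12 and Milne 2003 re-edition endnote 19] [cite: Grothendieck1966, footnote 13] -/
theorem abelianSchemeVHC_of_absoluteHodgeImpliesAlgebraicAV_of_principleB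
    (hB : deligne1982_principleB) (hZ : deligne1982_cycleClass_absoluteHodge)
    (h : AbsoluteHodgeImpliesAlgebraicAV) : AbelianSchemeVHC := by
  refine Ring2.Binders.abelianSchemeVHC_of_affine ?_
  intro n 𝒳 S f hf hirr haff hsm hab p W hW h₀ s
  haveI := haff
  haveI := hsm
  haveI : LocallyOfFiniteType S.hom := inferInstance
  obtain ⟨s₀, hs₀⟩ := h₀
  obtain ⟨A', -, hA'⟩ := hab s
  exact map_fiberι_mem_algebraicClasses_of_abelian_target_of_principleB hB hZ h f hf
    (IsQuasiProjectiveOver.of_isAffine S) hirr hsm p W (hW s₀).1 hs₀ s ⟨A', hA'⟩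

/-- (K3a) Hence the COMPACT-PENCIL node of the deform seat: `AbsoluteHodgeImpliesAlgebraicAV ⟹
Ring2.Deform.CompactAbelianPencilVHC` granted the two facts (count once: (K3) and
`Ring2.Deform.compactAbelianPencilVHC_of_abelianSchemeVHC`). [cite: Andre1996Motifs, §6.3 Remarque 2 (p. 33)]
[cite: Deligne1982HodgeCycles, Thm. 2.12] -/
theorem compactAbelianPencilVHC_of_absoluteHodgeImpliesAlgebraicAV_of_principleB
    (hB : deligne1982_principleB) (hZ : deligne1982_cycleClass_absoluteHodge)
    (h : AbsoluteHodgeImpliesAlgebraicAV) : Ring2.Deform.CompactAbelianPencilVHC :=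
  Ring2.Deform.compactAbelianPencilVHC_of_abelianSchemeVHC
    (abelianSchemeVHC_of_absoluteHodgeImpliesAlgebraicAV_of_principleB hB hZ h)

/-- (K3b) Hence the Weil-type ladder's variational rung R3var (`WeilTypeLadder.WeilVariationalHodgeCMField`) from
row b06, granted the two facts (count once: (K3) and the dictionary's `weilVariationalHodgeCMField_of_abelianSchemeVHC`).
[cite: CharlesSchnell2014Notes, Conj. 11.3.1] [cite: Deligne1982HodgeCycles, Thm. 2.12] -/
theorem weilVariationalHodgeCMField_of_absoluteHodgeImpliesAlgebraicAV_of_principleB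
    (hB : deligne1982_principleB) (hZ : deligne1982_cycleClass_absoluteHodge)
    (h : AbsoluteHodgeImpliesAlgebraicAV) : WeilTypeLadder.WeilVariationalHodgeCMField :=
  weilVariationalHodgeCMField_of_abelianSchemeVHC
    (abelianSchemeVHC_of_absoluteHodgeImpliesAlgebraicAV_of_principleB hB hZ h)

/-- (K3c) Hence the Weil-type ladder's variational rung R∞var (`WeilTypeLadder.WeilVariationalHodgeQuadratic`) from
row b06, granted the two facts (count once: (K3) and the dictionary's `weilVariationalHodgeQuadratic_of_abelianSchemeVHC`).
[cite: CharlesSchnell2014Notes, Conj. 11.3.1] [cite: Deligne1982HodgeCycles, Thm. 2.12] -/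
theorem weilVariationalHodgeQuadratic_of_absoluteHodgeImpliesAlgebraicAV_of_principleB
    (hB : deligne1982_principleB) (hZ : deligne1982_cycleClass_absoluteHodge)
    (h : AbsoluteHodgeImpliesAlgebraicAV) : WeilTypeLadder.WeilVariationalHodgeQuadratic :=
  weilVariationalHodgeQuadratic_of_abelianSchemeVHC
    (abelianSchemeVHC_of_absoluteHodgeImpliesAlgebraicAV_of_principleB hB hZ h)

/-! ## §3 Row b06 ⟹ row b08: the CM-local row WITHOUT `HC_CM` -/

/-- **(K4) `AbsoluteHodgeImpliesAlgebraicAV ⟹ LocalVHCAtCM` (row b06 ⟹ row b08), granted Principle B, Example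
2.1 (a) and Catanese's theorem (c21) — no `HC_CM`, no Main Theorem 2.11.** In the row's own typing (smooth
projective family `f : 𝒳 ⟶ S` of relative dimension `m`, `𝒳` and `S` quasi-projective, `S` smooth irreducible, a
CM abelian fibre `A₀ ≅ 𝒳_{s₀}` on which the global class `G` is ALGEBRAIC, `G` rational `(p,p)` on every fibre
presented as an abelian variety) the conclusion holds with `U = S(ℂ)`: the anchor is moved to the fibre `𝒳_{s₀}`
along the chart (`IsoTransport`), every fibre is an abelian variety of dimension `dim A₀ = m` (c21,
`catanese2002_abelianFibres_of_abelianFibre`; `Ring2.Binders.dim_eq_of_iso_fiberOver`), and (K2) applies at every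
`t`. The CM hypothesis `IsCM[A₀]` is IDLE on this road (any algebraic anchor fibre does); in the dictionary it is
`HC_CM` that makes the CM fibre an algebraic anchor — here algebraicity at `A₀` is the row's hypothesis, as filed.
[cite: CharlesSchnell2014Notes, §11.3.2 (first paragraph), Thm. 11.3.7 and Conj. 11.3.1]
[cite: Deligne1982HodgeCycles, Example 2.1 (a), Thm. 2.12 and Prop. 6.1] [cite: Catanese2002DeformationTypes, §4 Thm. 4.1 and Thm. 4.6] -/
theorem localVHCAtCM_of_absoluteHodgeImpliesAlgebraicAV_of_principleB_of_catanese
    (hB : deligne1982_principleB) (hZ : deligne1982_cycleClass_absoluteHodge)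
    (hC : catanese2002_abelianFibres_of_abelianFibre) (h : AbsoluteHodgeImpliesAlgebraicAV) :
    LocalVHCAtCM := by
  intro S 𝒳 f m p G s₀ A₀ e₀ h𝒳 hS hsm hirr hf hA₀ _ halg hG
  obtain ⟨i, hi⟩ := hA₀
  haveI := hirr
  -- the anchor `A₀ ≅ 𝒳_{s₀}`: rational and algebraic on THE fibre `𝒳_{s₀}`
  have hG₀ := hG A₀ e₀ s₀ ⟨i, hi⟩
  have he₀ : complexBetti.map e₀ (2 * p) G =
      complexBetti.map i.hom (2 * p) (complexBetti.map (fiberι f s₀) (2 * p) G) := by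
    rw [hi, complexBetti.map_comp]
    rfl
  rw [he₀] at halg hG₀
  have hrat : IsRationalClass (complexBetti.map (fiberι f s₀) (2 * p) G) :=
    (isRationalClass_map_iff_of_iso i).1 hG₀.1
  have halg₀ : complexBetti.map (fiberι f s₀) (2 * p) G ∈ algebraicClasses (fiberOver f s₀) p :=
    (mem_algebraicClasses_map_iff_of_iso i).1 halg
  -- every fibre is an abelian variety (Catanese), the family having relative dimension `dim A₀ = m`
  have hdim : A₀.dim = m := Ring2.Binders.dim_eq_of_iso_fiberOver hf i
  have hfam : IsSmoothProjectiveFamily f A₀.dim := hdim ▸ hf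
  refine ⟨Set.univ, isOpen_univ, Set.mem_univ _, fun t _ => ?_⟩
  obtain ⟨B, -, hBt⟩ := hC f A₀ h𝒳 hS hirr hsm hfam ⟨s₀, ⟨i⟩⟩ t
  exact map_fiberι_mem_algebraicClasses_of_abelian_target_of_principleB hB hZ h f hf hS hirr hsm p G
    hrat halg₀ t ⟨B, hBt⟩

/-! ## §4 Consequences by composition (count once): `HC_CM`, `HC_AV` as CONCLUSIONS of row b06 on a 2.11-free road -/

/-- **(K5a) `AbsoluteHodgeImpliesAlgebraicAV ⟹ HC_CM`** granted Principle B, Example 2.1 (a) and André 1996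
Lemmes 6.3.2–6.3.3 (`andre1996_cmHodgeClasses_algebraicallyAnchoredPencils`): (K3) and the deform seat's (D′)
`Ring2.Deform.HC_CM_of_andre1996_of_abelianSchemeVHC`. `HC_CM` is a CONCLUSION on this road, never an input;
compare the dictionary's `hc_cm_of_deligne_of_absoluteHodgeImpliesAlgebraicAV` (modulo Main Thm. 2.11 instead).
[cite: Andre1996Motifs, Lemmes 6.3.2–6.3.3 and Remarque 2 (pp. 32–33)] [cite: Deligne1982HodgeCycles, Thm. 2.12] -/
theorem hc_cm_of_absoluteHodgeImpliesAlgebraicAV_of_principleB_of_andre1996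
    (hB : deligne1982_principleB) (hZ : deligne1982_cycleClass_absoluteHodge)
    (h₂₂ : andre1996_cmHodgeClasses_algebraicallyAnchoredPencils) (h : AbsoluteHodgeImpliesAlgebraicAV) :
    Theses.RankFourFaces.CMAbelianHodge :=
  Ring2.Deform.HC_CM_of_andre1996_of_abelianSchemeVHC h₂₂
    (abelianSchemeVHC_of_absoluteHodgeImpliesAlgebraicAV_of_principleB hB hZ h)

/-- **(K5b) `AbsoluteHodgeImpliesAlgebraicAV ⟹ HC_AV`** granted Principle B, Example 2.1 (a) and André 1996
Lemmes 6.3.1–6.3.3 (`andre1996_cmAnchoredPencil`, `andre1996_cmHodgeClasses_algebraicallyAnchoredPencils`): (K3) and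
the deform seat's (M′) `Ring2.Deform.HC_AV_of_andre1996_of_abelianSchemeVHC`. Compare the dictionary's
`hc_av_of_deligne_of_absoluteHodgeImpliesAlgebraicAV` (modulo Main Thm. 2.11): Deligne's proof of 2.11 IS Principle B
plus a CM reduction, here run with "algebraic" in place of "absolute Hodge" and André's §6.3 as the CM step.
[cite: Andre1996Motifs, §6.3 (pp. 31–33)] [cite: Deligne1982HodgeCycles, Thm. 2.12 and Prop. 6.1] -/
theorem hc_av_of_absoluteHodgeImpliesAlgebraicAV_of_principleB_of_andre1996
    (hB : deligne1982_principleB) (hZ : deligne1982_cycleClass_absoluteHodge)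
    (h₂₁ : andre1996_cmAnchoredPencil) (h₂₂ : andre1996_cmHodgeClasses_algebraicallyAnchoredPencils)
    (h : AbsoluteHodgeImpliesAlgebraicAV) : Theses.PadicSemiregularLift.HodgeAbelianVarieties :=
  Ring2.Deform.HC_AV_of_andre1996_of_abelianSchemeVHC h₂₁ h₂₂
    (abelianSchemeVHC_of_absoluteHodgeImpliesAlgebraicAV_of_principleB hB hZ h)

/-- **(K5c) EXACTNESS, 2.11-free: `HC_AV ↔ AbsoluteHodgeImpliesAlgebraicAV`** granted Principle B, Example 2.1 (a)
and André's Lemmes 6.3.1–6.3.3 (`⟸` is (K5b); `⟹` is the on-path `absoluteHodgeImpliesAlgebraicAV_of_hc_av`, fact-free).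
A second modulus for the dictionary cell "row b06 ≡ `HC_AV`" next to `hc_av_iff_absoluteHodgeImpliesAlgebraicAV_of_deligne`
(Main Thm. 2.11). [cite: Deligne1982HodgeCycles, Introduction (principle B) and Main Thm. 2.11]
[cite: Andre1996Motifs, §6.3 Remarque 2 (p. 33)] -/
theorem hc_av_iff_absoluteHodgeImpliesAlgebraicAV_of_principleB_of_andre1996
    (hB : deligne1982_principleB) (hZ : deligne1982_cycleClass_absoluteHodge)
    (h₂₁ : andre1996_cmAnchoredPencil) (h₂₂ : andre1996_cmHodgeClasses_algebraicallyAnchoredPencils) :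
    Theses.PadicSemiregularLift.HodgeAbelianVarieties ↔ AbsoluteHodgeImpliesAlgebraicAV :=
  ⟨absoluteHodgeImpliesAlgebraicAV_of_hc_av,
    hc_av_of_absoluteHodgeImpliesAlgebraicAV_of_principleB_of_andre1996 hB hZ h₂₁ h₂₂⟩

/-- **(K5d) EXACTNESS between the rows: `AbsoluteHodgeImpliesAlgebraicAV ↔ AbelianSchemeVHC`** (row b06 ≡ row b02)
granted Principle B, Example 2.1 (a) and André's Lemmes 6.3.1–6.3.3: `⟹` is (K3) (two facts); `⟸` passes through
`HC_AV` (the deform seat's (M′), then the on-path lemma). [cite: Andre1996Motifs, §6.3 Remarque 2 (p. 33)]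
[cite: Deligne1982HodgeCycles, Thm. 2.12 and Milne 2003 re-edition endnote 19] -/
theorem absoluteHodgeImpliesAlgebraicAV_iff_abelianSchemeVHC_of_principleB_of_andre1996
    (hB : deligne1982_principleB) (hZ : deligne1982_cycleClass_absoluteHodge)
    (h₂₁ : andre1996_cmAnchoredPencil) (h₂₂ : andre1996_cmHodgeClasses_algebraicallyAnchoredPencils) :
    AbsoluteHodgeImpliesAlgebraicAV ↔ AbelianSchemeVHC :=
  ⟨abelianSchemeVHC_of_absoluteHodgeImpliesAlgebraicAV_of_principleB hB hZ, fun hV =>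
    absoluteHodgeImpliesAlgebraicAV_of_hc_av (Ring2.Deform.HC_AV_of_andre1996_of_abelianSchemeVHC h₂₁ h₂₂ hV)⟩

/-! ## §5 What `HC_CM` is worth on the absolute axis: Deligne's Main Theorem 2.11 from `HC_CM`, the CM-anchored
Mumford–Tate families and Principle B — and the CM pivot with row b06 in place of row b08 -/

/-- **(K6) `HC_CM ∧ CMAnchoredFamilies ⟹` Deligne's Main Theorem 2.11 (the named fact c1
`deligne1982_hodgeClasses_abelianVariety_absoluteHodge`: every Hodge class on every complex abelian variety is an
absolute Hodge class), granted Principle B and Example 2.1 (a).** Deligne's own reduction (Introduction p. 6: "one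
shows that it suffices to prove the main result for `A` an abelian variety of CM-type"; Prop. 6.1 + Thm. 2.12) with
the CM case of absoluteness (his §§3–5) REPLACED by `HC_CM`: a rational `(p,p)` class `c` on `A` is `e^* G` for a
class `G` on a smooth projective family over a smooth irreducible quasi-projective base through `A ≅ 𝒳_t` and a CM
fibre `A₀ ≅ 𝒳_{s₀}` (row b07 `CMAnchoredFamilies`, CITE: `⟸` c8 by `Ring2.Deform.cmAnchoredFamilies_of_deligne1982`);
`G|_{A₀}` is rational `(p,p)`, hence ALGEBRAIC by `HC_CM` (eigenvalue typing via the tree's bridge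
`CMPivot.hodgeCM_of_cmAbelianHodge`), hence absolute Hodge on `𝒳_{s₀}` (Ex. 2.1 (a)), hence `G|_{𝒳_t}` is absolute
Hodge (Principle B), hence so is `c = e^* G` on `A` (`Theorems.stub_absoluteOfIso` along `A.X ≅ 𝒳_t`). `HC_CM` — BY
NAME `Theses.RankFourFaces.CMAbelianHodge`, a binder — is LOAD-BEARING here: it supplies the CM step. NOT a discharge of
c1 (two open/CITE inputs). [cite: Deligne1982HodgeCycles, Introduction p. 6, Main Thm. 2.11, Thm. 2.12 and Prop. 6.1]
[cite: CharlesSchnell2014Notes, Thm. 11.3.7 and Thm. 11.5.11] -/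
theorem deligne1982_mainTheorem_of_hc_cm_of_cmAnchoredFamilies_of_principleB
    (hCM : Theses.RankFourFaces.CMAbelianHodge) (hMT : CMAnchoredFamilies)
    (hB : deligne1982_principleB) (hZ : deligne1982_cycleClass_absoluteHodge) :
    deligne1982_hodgeClasses_abelianVariety_absoluteHodge := by
  intro A p c hc hpp
  obtain ⟨S, 𝒳, f, G, t, s₀, e, A₀, e₀, h𝒳, hS, hsm, hirr, hf, ⟨i, hi⟩, ⟨i₀, hi₀⟩, hA₀, hGc, hG⟩ :=
    hMT A p c hc hpp
  haveI := hirr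
  -- the CM anchor: `G|_{A₀}` is rational `(p,p)`, hence algebraic by `HC_CM`, read on THE fibre `𝒳_{s₀}`
  have hG₀ := hG A₀ e₀ s₀ ⟨i₀, hi₀⟩
  have he₀ : complexBetti.map e₀ (2 * p) G =
      complexBetti.map i₀.hom (2 * p) (complexBetti.map (fiberι f s₀) (2 * p) G) := by
    rw [hi₀, complexBetti.map_comp]
    rfl
  rw [he₀] at hG₀
  have halgA₀ : complexBetti.map i₀.hom (2 * p) (complexBetti.map (fiberι f s₀) (2 * p) G) ∈
      algebraicClasses A₀.X p :=
    (Theorems.HodgeAbelianVarieties.CMPivot.hodgeCM_of_cmAbelianHodge hCM A₀ hA₀).2 p _ hG₀.1 hG₀.2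
  have hrat : IsRationalClass (complexBetti.map (fiberι f s₀) (2 * p) G) :=
    (isRationalClass_map_iff_of_iso i₀).1 hG₀.1
  have halg₀ : complexBetti.map (fiberι f s₀) (2 * p) G ∈ algebraicClasses (fiberOver f s₀) p :=
    (mem_algebraicClasses_map_iff_of_iso i₀).1 halgA₀
  -- Principle B along the family: `G|_{𝒳_t}` is absolute Hodge; move it to `A` along the chart `i : A.X ≅ 𝒳_t`
  have habs : IsAbsoluteHodgeClass A.dim (fiberOver f t) p (complexBetti.map (fiberι f t) (2 * p) G) :=
    hB.isAbsoluteHodgeClass_map_fiberι_of_mem_algebraicClasses hZ ⟨hf, hS, hsm⟩ G hrat halg₀ t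
  have he : c = complexBetti.map i.hom (2 * p) (complexBetti.map (fiberι f t) (2 * p) G) := by
    rw [← hGc, hi, complexBetti.map_comp]
    rfl
  rw [he]
  exact Theorems.stub_absoluteOfIso i (hf.isSmoothProjective t) ((hf.isSmoothProjective t).of_iso i.symm) p _ habs

/-- **(K6′) The same from the printed fact c8 directly**: `HC_CM ∧ [Deligne 1982 Prop. 6.1 / Charles–Schnell
Thm. 11.5.11, CM-dense Mumford–Tate families] ⟹` Main Theorem 2.11, granted Principle B and Example 2.1 (a)
(row b07 `⟸` c8 is the deform seat's `Ring2.Deform.cmAnchoredFamilies_of_deligne1982`; count once).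
[cite: Deligne1982HodgeCycles, Prop. 6.1 and Thm. 2.12] [cite: CharlesSchnell2014Notes, Thm. 11.5.11] -/
theorem deligne1982_mainTheorem_of_hc_cm_of_deligne1982_of_principleB
    (hCM : Theses.RankFourFaces.CMAbelianHodge) (h₈ : deligne1982_cmDenseMumfordTateFamilies)
    (hB : deligne1982_principleB) (hZ : deligne1982_cycleClass_absoluteHodge) :
    deligne1982_hodgeClasses_abelianVariety_absoluteHodge :=
  deligne1982_mainTheorem_of_hc_cm_of_cmAnchoredFamilies_of_principleB hCM
    (Ring2.Deform.cmAnchoredFamilies_of_deligne1982 h₈) hB hZ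

/-- **(K7) The CM pivot with row b06 in place of row b08: `HC_CM ∧ CMAnchoredFamilies ∧
AbsoluteHodgeImpliesAlgebraicAV ⟹ HC_AV`, granted Principle B and Example 2.1 (a).** (K6) gives Main Theorem 2.11,
and the dictionary's `hc_av_of_deligne_of_absoluteHodgeImpliesAlgebraicAV` finishes. Compare the dictionary's
`hc_av_of_hc_cm_of_cmAnchoredFamilies_of_localVHCAtCM` (third input `LocalVHCAtCM`, no Literature fact) and
`hc_av_of_deligne_of_absoluteHodgeImpliesAlgebraicAV` (row b06 alone, modulo c1): `HC_CM` and row b07 replace c1,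
nothing more (honest column (4)). [cite: Deligne1982HodgeCycles, Introduction p. 6, Main Thm. 2.11 and Prop. 6.1] -/
theorem hc_av_of_hc_cm_of_cmAnchoredFamilies_of_absoluteHodgeImpliesAlgebraicAV_of_principleB
    (hCM : Theses.RankFourFaces.CMAbelianHodge) (hMT : CMAnchoredFamilies)
    (hB : deligne1982_principleB) (hZ : deligne1982_cycleClass_absoluteHodge)
    (h : AbsoluteHodgeImpliesAlgebraicAV) : Theses.PadicSemiregularLift.HodgeAbelianVarieties :=
  hc_av_of_deligne_of_absoluteHodgeImpliesAlgebraicAV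
    (deligne1982_mainTheorem_of_hc_cm_of_cmAnchoredFamilies_of_principleB hCM hMT hB hZ) h

/-- **(K7′) Item-16267 typing**: `CMAnchoredFamilies ∧ AbsoluteHodgeImpliesAlgebraicAV ⟹ CMToAbelian` ("`HC_CM ⟹
HC_AV`", stmt-HodgeConjecture-16267), granted Principle B and Example 2.1 (a) — the transport half of the CM pivot
with row b06 as the transport input. [cite: Deligne1982HodgeCycles, Prop. 6.1 and Thm. 2.12] -/
theorem cmToAbelian_of_cmAnchoredFamilies_of_absoluteHodgeImpliesAlgebraicAV_of_principleB
    (hMT : CMAnchoredFamilies) (hB : deligne1982_principleB) (hZ : deligne1982_cycleClass_absoluteHodge)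
    (h : AbsoluteHodgeImpliesAlgebraicAV) : Theses.RankFourFaces.CMToAbelian :=
  fun hCM A _ =>
    hc_av_of_hc_cm_of_cmAnchoredFamilies_of_absoluteHodgeImpliesAlgebraicAV_of_principleB hCM hMT hB hZ h A

/-! ## Audit: nothing is decided here

Every theorem has among its hypotheses the OPEN row `AbsoluteHodgeImpliesAlgebraicAV` and/or the OPEN binder `HC_CM`
(`Theses.RankFourFaces.CMAbelianHodge`, §5 only) and/or the CITE row `CMAnchoredFamilies` (or, in the `iff`s,
concludes an equivalence between open statements), next to printed theorems that are hypotheses in Lean by name.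
Axiom closures: the three standard axioms. -/

#print axioms Summit.HodgeConjecture.HodgeConjecture.Ring2.Hypotheses.absoluteHodge_algebraic_of_iso_abelianVariety
#print axioms Summit.HodgeConjecture.HodgeConjecture.Ring2.Hypotheses.abelianSchemeVHC_of_absoluteHodgeImpliesAlgebraicAV_of_principleB
#print axioms Summit.HodgeConjecture.HodgeConjecture.Ring2.Hypotheses.localVHCAtCM_of_absoluteHodgeImpliesAlgebraicAV_of_principleB_of_catanese
#print axioms Summit.HodgeConjecture.HodgeConjecture.Ring2.Hypotheses.hc_av_iff_absoluteHodgeImpliesAlgebraicAV_of_principleB_of_andre1996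
#print axioms Summit.HodgeConjecture.HodgeConjecture.Ring2.Hypotheses.deligne1982_mainTheorem_of_hc_cm_of_cmAnchoredFamilies_of_principleB
#print axioms Summit.HodgeConjecture.HodgeConjecture.Ring2.Hypotheses.hc_av_of_hc_cm_of_cmAnchoredFamilies_of_absoluteHodgeImpliesAlgebraicAV_of_principleB

end Summit.HodgeConjecture.HodgeConjecture.Ring2.Hypotheses

end
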